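import Summits.BirchSwinnertonDyer.BirchSwinnertonDyer.Theorems.ByReductionTypeAtTwoTorsionEulerCharKerG
import Summits.BirchSwinnertonDyer.BirchSwinnertonDyer.Theorems.PublishedInputsGreenbergSigmaDivAnyTorsion
import Summits.BirchSwinnertonDyer.BirchSwinnertonDyer.Theorems.ThetaPartnerAtTwoSignedControlAtTwoH1SigmaCorankBound
import HarnessLib

set_option linter.dupNamespace false -- `…BirchSwinnertonDyer.BirchSwinnertonDyer…` is the cell's nested layout (D-0017)
set_option autoImplicit false

/-!
# Greenberg LNM 1716 Lemma 4.7 WITH RATIONAL `p`-TORSION, part 2: the three descents behind the INEQUALITY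
# `∏_{v∈S} #𝒦_{v,0}[p^∞] · #(Sel_{p^∞}(E/K_∞))_Γ ≤ #ker g₀ · #C_{v₀}` (`C_{v₀}` = Cassels' cokernel read at one auxiliary place)

Cell `bsd-2adic` (run/shared/lean/pub/bsd-2adic/), seat `bsd-2adic-tower-1` GEN 31; `--supports stmt-BirchSwinnertonDyer-19271`
(helper). THEOREMS ONLY (no definition, no named fact, no `sorry`); closes no item; nothing booked; BSD is not proved by any of this.

R. Greenberg, *Iwasawa theory for elliptic curves*, LNM 1716 (1999), §4 Lemma 4.7 (pp. 107–108): `|ker g| = |ker r|·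
|(Sel_E(F_∞)_p)_Γ|/|E(F)_p|` — the snake `0 → ker g → ker r → ker t → 0` over Cassels' `𝒫_E^Σ(F)/𝒢_E^Σ(F) ≅ E(F)_p^∧`
(p. 104) and the SURJECTION `t : 𝒫^Σ(F)/𝒢^Σ(F) ↠ (Sel_E(F_∞)_p)_Γ` (which needs Lemma 4.6, the surjectivity of
`H¹(F_Σ/F_∞, E[p^∞]) → 𝒫_E^Σ(F_∞)`, proved in print by twisting). This file proves the HALF of Lemma 4.7 that does NOT
need Lemma 4.6, for every number field `K`, every prime `p`, the cyclotomic `ℤ_p`-extension, NO hypothesis on `E(K)[p]`: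

  **`∏_{v ∈ S} #𝒦_{v,0}[p^∞] · #(Sel_{p^∞}(E/K_∞))_γ ≤ #(A₀/Sel₀) · #C_{v₀}`**,

where `v₀ ∉ S ⊇ {bad} ∪ {v ∣ p}` is an auxiliary place, `C_{v₀} = H¹(Γ_{K_{v₀}}, E)(p) / loc_{v₀}(U)` and `U` is the group of
classes of `H¹(Γ_K, E[p^∞])` unramified outside `S ∪ {v₀}` whose local classes vanish on `S` and at the infinite places —
Cassels' cokernel `𝒫^{S∪{v₀}}/𝒢` read at `v₀` (by Cassels-with-torsion AWAY from `v₀`,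
`InputsGreenbergCasselsTorsion.casselsSurjectivity_H1Sigma_eraseOne`, k4-p1 gen 7, every `p`-power-torsion local vector on
`S ∪ ∞` is realised by such a class, the defect sitting at `v₀`). Mechanism (Greenberg's diagram with `𝒫/𝒢` replaced by
`C_{v₀}`): (I) the classes `Θ` realising the vectors of `∏ 𝒦_{v,0}` map to `C_{v₀}` with kernel landing in `Ψ(A₀/Sel₀)`
(part 1's criterion), so `[∏ 𝒦 : Ψ(A₀/Sel₀)] ≤ #D`, `D` = image of `Θ` in `C_{v₀}`; (II) every class of `(Sel_∞)_γ` is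
`(γ−1)t` with `t` Selmer away from `v₀` and `loc_{v₀} t = r_{v₀}(z₀)` («DIV» + local surjectivity + AEU + erase-one), and
`[z₀] ∈ D` forces `(γ−1)t ∈ (γ−1)Sel_∞`; so `#(Sel_∞)_γ ≤ #(C_{v₀}/D)`; (III) multiply. The reverse inequality is exactly
Lemma 4.6 on `Γ`-invariants and is NOT claimed. With Lemmas 4.2/4.3 (tree, `…_of_finite_selmerGroup`, carrying `#E[p^∞]^{Γ_K}`)
and Cassels' count `#C_{v₀} ≤ #E(K)[p^∞]` (Prop. 4.13 with torsion; sequel) this is the «upper-half» direction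
`ord_p f_E(0) + 2·ord_p #E(K)_p ≥ ord_p #Sel + ord_p ∏ #𝒦_{v,0}` of Theorem 4.1 / its multiplicative analogue (p. 112).

* `exists_lift_of_pi_localTowerKerPrimary` — erase-one at `v₀`: every vector of `∏_{v∈S} 𝒦_{v,0}[p^∞]` is `(loc_v Y)_v`
  for a class `Y` unramified outside `S ∪ {v₀}` vanishing at `∞`.
* `exists_coinv_representative` — (II), first half: the representative `(t, z₀)` of a class of `(Sel_∞)_γ`.
* `exists_mem_selmerInfty_conj_sub_eq_of_lift` — (II), second half: a `Θ`-lift of `z₀` kills the class.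
* part 3 (`…TorsionEulerCharIneq`) multiplies these out into THE INEQUALITY (hypotheses: `Sel_{p^∞}(E/K)` finite, «DIV»
  for `H¹(K_∞, E[p^∞])`, local surjectivity `𝒫_E(K_v)[p^∞] ↠ 𝒫_E(K_{∞,η})[p^∞]^{Γ_v}` at every finite `v`, finiteness of
  the `𝒦_{v,0}` on `S` and of `C_{v₀}`).

HONEST FRAMING: one half of a printed lemma, kernel-checked from tree theorems; the other half (Lemma 4.6^Γ) is open in the
tree. Closes no item; no summit statement is proved; the Birch–Swinnerton-Dyer conjecture is NOT proved by any of this.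

References: [GreenbergLNM1716] §4 p. 104, Lemmas 4.6–4.7 (pp. 105–108), Prop. 4.13 and p. 123; [GreenbergVatsal2000] §2
pp. 16–17; [MilneADT2006] I Thm. 4.10, Thm. 6.13.
-/

noncomputable section

open scoped Classical NumberField

open NumberField IsDedekindDomain Field

namespace Summit.BirchSwinnertonDyer.BirchSwinnertonDyer.Theorems.TorsionEulerChar

open Literature.NumberTheory.EllipticCurves Literature.NumberTheory.GaloisRepresentations
  WeierstrassCurve ZpExtension Literature.NumberTheory.EllipticCurves.IwasawaAlgebra
  Literature.NumberTheory.EllipticCurves.IwasawaDual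
  Literature.NumberTheory.EllipticCurves.GreenbergVatsal2000 Literature.NumberTheory.EllipticCurves.GreenbergSelmer
  Literature.NumberTheory.EllipticCurves.Rank1Residual Summit.BirchSwinnertonDyer.Rank1Residual.X2

variable {K : Type} [Field K] [NumberField K] (W : WeierstrassCurve K) [W.IsElliptic] (p : ℕ) [hp : Fact p.Prime]
  (κ : ZpExtension K p) {γ : absoluteGaloisGroup K}

/-! ## §1 Erase-one at `v₀`: lifting a vector of `∏_{v ∈ S} 𝒦_{v,0}[p^∞]` -/

/-- **Every vector of `∏_{v ∈ S} 𝒦_{v,0}[p^∞]` is the local vector of a global class unramified outside `S ∪ {v₀}` and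
vanishing at the infinite places** (`Sel_{p^∞}(E/K)` finite; Cassels-with-torsion away from `v₀`,
`casselsSurjectivity_H1Sigma_eraseOne`, the local classes `x_v` at `v ∈ S`, `0` at `∞`; nothing is prescribed at `v₀`).
[cite: GreenbergLNM1716, §4 Appendix, Prop. 4.13 and p. 123] [cite: MilneADT2006, Ch. I, Thm. 4.10 (b) and Thm. 6.13] -/
theorem exists_lift_of_pi_localTowerKerPrimary (hSel : Finite (W.selmerGroupPInfty p))
    (S : Finset (HeightOneSpectrum (𝓞 K))) (hS : ∀ v ∉ S, ((p : ℕ) : 𝓞 K) ∉ v.asIdeal ∧ W.HasGoodReductionAt v)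
    (v₀ : HeightOneSpectrum (𝓞 K)) (hv₀ : v₀ ∉ S) (x : ∀ v : S, W.localTowerKerPrimary κ (v.1.adicCompletion K) 0) :
    ∃ Y : W.subgroupH1 p (⊤ : Subgroup (absoluteGaloisGroup K)),
      Y ∈ unramifiedOutside (⊤ : Subgroup (absoluteGaloisGroup K)) (W.geomPrimaryTorsion p) p
          ((↑S : Set (HeightOneSpectrum (𝓞 K))) ∪ {v₀}) ∧
      (∀ v (hv : v ∈ S), W.localResOver p ⊤ (v.adicCompletion K) Y =
        Literature.NumberTheory.EllipticCurves.resOfLe (localPoints W (v.adicCompletion K))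
          (Subgroup.comap_mono (ZpExtension.layerSubgroup_zero (κ := κ)).ge :
            localSubgroup (⊤ : Subgroup (absoluteGaloisGroup K)) (v.adicCompletion K) ≤
              localSubgroup (κ.layerSubgroup 0) (v.adicCompletion K))
          ((x ⟨v, hv⟩ : W.localTowerKerPrimary κ (v.adicCompletion K) 0) :
            discreteH1 (localSubgroup (κ.layerSubgroup 0) (v.adicCompletion K)) (localPoints W (v.adicCompletion K)))) ∧
      ∀ w : InfinitePlace K, W.localResOver p ⊤ w.Completion Y = 0 := by
  have hgeK : (⊤ : Subgroup (absoluteGaloisGroup K)) ≤ κ.layerSubgroup 0 := (ZpExtension.layerSubgroup_zero (κ := κ)).ge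
  have hge : ∀ (E : Type) [Field E] [Algebra K E],
      localSubgroup (⊤ : Subgroup (absoluteGaloisGroup K)) E ≤ localSubgroup (κ.layerSubgroup 0) E :=
    fun E _ _ ↦ Subgroup.comap_mono hgeK
  let xS : ∀ v : HeightOneSpectrum (𝓞 K),
      discreteH1 (localSubgroup (⊤ : Subgroup (absoluteGaloisGroup K)) (v.adicCompletion K))
        (localPoints W (v.adicCompletion K)) := fun v ↦
    if h : v ∈ S then Literature.NumberTheory.EllipticCurves.resOfLe (localPoints W (v.adicCompletion K))
      (hge (v.adicCompletion K)) ((x ⟨v, h⟩ : W.localTowerKerPrimary κ (v.adicCompletion K) 0) :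
        discreteH1 (localSubgroup (κ.layerSubgroup 0) (v.adicCompletion K)) (localPoints W (v.adicCompletion K))) else 0
  have hxS : ∀ v (h : v ∈ S), xS v = Literature.NumberTheory.EllipticCurves.resOfLe (localPoints W (v.adicCompletion K))
      (hge (v.adicCompletion K)) ((x ⟨v, h⟩ : W.localTowerKerPrimary κ (v.adicCompletion K) 0) :
        discreteH1 (localSubgroup (κ.layerSubgroup 0) (v.adicCompletion K)) (localPoints W (v.adicCompletion K))) :=
    fun v h ↦ dif_pos h
  have hxS_tor : ∀ v, ∃ k : ℕ, p ^ k • xS v = 0 := fun v ↦ by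
    by_cases h : v ∈ S
    · obtain ⟨-, k, hk⟩ := (W.mem_localTowerKerPrimary_iff κ _ 0 _).mp (x ⟨v, h⟩).2
      exact ⟨k, by rw [hxS v h, ← map_nsmul, hk, map_zero]⟩
    · rw [show xS v = 0 from dif_neg h]; exact ⟨0, smul_zero _⟩
  let xi : ∀ w : InfinitePlace K,
      discreteH1 (localSubgroup (⊤ : Subgroup (absoluteGaloisGroup K)) w.Completion) (localPoints W w.Completion) :=
    fun _ ↦ 0
  obtain ⟨Y, hYH, hYfin, hYinf⟩ := InputsGreenbergCasselsTorsion.casselsSurjectivity_H1Sigma_eraseOne W p hSel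
    ((↑S : Set (HeightOneSpectrum (𝓞 K))) ∪ {v₀}) (S.finite_toSet.union (Set.finite_singleton v₀))
    (fun v hv hpv ↦ (hS v (fun h ↦ hv (Or.inl (Finset.mem_coe.mpr h)))).2) v₀ (Or.inl (Or.inr rfl))
    xS xi hxS_tor (fun _ ↦ ⟨0, smul_zero _⟩)
  refine ⟨Y, hYH, fun v hv ↦ ?_, hYinf⟩
  have hne : v ≠ v₀ := fun h ↦ hv₀ (h ▸ hv)
  exact (hYfin v (Or.inl (Or.inl (Finset.mem_coe.mpr hv))) hne).trans (hxS v hv)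

/-! ## §2 The representative `(t, z₀)` of a class of `(Sel_∞)_γ` -/

/-- **Every class of `(Sel_{p^∞}(E/K_∞))_γ` has a representative `(γ−1)t` with `t` Selmer away from `v₀` and
`loc_{v₀} t = r_{v₀}(z₀)`, `z₀ ∈ H¹(Γ_{K_{v₀}}, E)[p^∞]`** — for `W/K` elliptic, `κ` CYCLOTOMIC with topological generator `γ`,
`Sel_{p^∞}(E/K)` finite, GIVEN «DIV» for `H¹(K_∞, E[p^∞])` (`hdiv`) and the local surjectivity
`𝒫_E(K_v)[p^∞] ↠ 𝒫_E(K_{∞,η})[p^∞]^{Γ_v}` at every finite place (`hsurj`, Greenberg p. 108). PROOF = k4-p1's Cassels descent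
(`InputsGreenbergSelmerCoinv.exists_mem_selmerInfty_conjH1_sub_eq`: DIV, AEU, local lifts) with Cassels replaced by
Cassels-with-torsion AWAY FROM `v₀`; the unrealised local class at `v₀` is `z₀ = x_{v₀} − loc_{v₀} y`.
[cite: GreenbergLNM1716, §4 p. 104, Lemma 4.7 (pp. 107–108), Prop. 4.13 and p. 123] [cite: GreenbergVatsal2000, §2 pp. 16–17] -/
theorem exists_coinv_representative (hκ : κ.IsCyclotomic) (hγ : κ.IsTopGenerator γ)
    (hSel : Finite (W.selmerGroupPInfty p))
    (hdiv : ∀ s : W.subgroupH1 p κ.kerSubgroup,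
      ∃ t : W.subgroupH1 p κ.kerSubgroup, W.conjH1 p κ.kerSubgroup γ t - t = s)
    (hsurj : ∀ (v : HeightOneSpectrum (𝓞 K))
      (c : discreteH1 (localSubgroup κ.kerSubgroup (v.adicCompletion K)) (localPoints W (v.adicCompletion K))),
      (∃ k : ℕ, p ^ k • c = 0) →
      (∀ δ : absoluteGaloisGroup (v.adicCompletion K),
        Literature.NumberTheory.EllipticCurves.conjH1 (localSubgroup κ.kerSubgroup (v.adicCompletion K))
          (localPoints W (v.adicCompletion K)) δ c = c) →
      ∃ x : discreteH1 (localSubgroup (⊤ : Subgroup (absoluteGaloisGroup K)) (v.adicCompletion K))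
          (localPoints W (v.adicCompletion K)),
        (∃ k : ℕ, p ^ k • x = 0) ∧
        Literature.NumberTheory.EllipticCurves.resOfLe (localPoints W (v.adicCompletion K))
          (Subgroup.comap_mono le_top :
            localSubgroup κ.kerSubgroup (v.adicCompletion K) ≤
              localSubgroup (⊤ : Subgroup (absoluteGaloisGroup K)) (v.adicCompletion K)) x = c)
    (v₀ : HeightOneSpectrum (𝓞 K)) (s : W.subgroupH1 p κ.kerSubgroup) (hs : s ∈ W.selmerInfty κ) :
    ∃ (t : W.subgroupH1 p κ.kerSubgroup)
      (z₀ : discreteH1 (localSubgroup (⊤ : Subgroup (absoluteGaloisGroup K)) (v₀.adicCompletion K))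
        (localPoints W (v₀.adicCompletion K))),
      W.conjH1 p κ.kerSubgroup γ t - t = s ∧
      (∀ v : HeightOneSpectrum (𝓞 K), v ≠ v₀ → t ∈ W.localKerOver p κ.kerSubgroup (v.adicCompletion K)) ∧
      (∀ w : InfinitePlace K, t ∈ W.localKerOver p κ.kerSubgroup w.Completion) ∧
      (∃ k : ℕ, p ^ k • z₀ = 0) ∧
      W.localResOver p κ.kerSubgroup (v₀.adicCompletion K) t =
        Literature.NumberTheory.EllipticCurves.resOfLe (localPoints W (v₀.adicCompletion K))
          (Subgroup.comap_mono le_top :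
            localSubgroup κ.kerSubgroup (v₀.adicCompletion K) ≤
              localSubgroup (⊤ : Subgroup (absoluteGaloisGroup K)) (v₀.adicCompletion K)) z₀ := by
  -- adapted from `InputsGreenbergSelmerCoinv.exists_mem_selmerInfty_conjH1_sub_eq` (bsd-inputs-k4-p1 gen 4)
  set Sel : AddSubgroup (W.subgroupH1 p κ.kerSubgroup) := W.selmerInfty κ with hSeldef
  obtain ⟨t, ht⟩ := hdiv s -- DIV in the full group `H¹(K_∞, E[p^∞])`
  have hstab : ∀ (σ : absoluteGaloisGroup K), ∀ x ∈ Sel, W.conjH1 p κ.kerSubgroup σ x ∈ Sel := fun σ x hx ↦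
    W.map_conjH1_selmerGroupOver_le_holds p κ.kerSubgroup σ ⟨x, hx, rfl⟩
  have htγ : W.conjH1 p κ.kerSubgroup γ t - t ∈ Sel := by rw [ht]; exact hs
  have htall : ∀ σ : absoluteGaloisGroup K, W.conjH1 p κ.kerSubgroup σ t - t ∈ Sel :=
    SSFlatEC.conjH1_sub_mem_of_conjH1_generator_sub_mem W κ hγ Sel hstab htγ
  have honeK : ∀ {A : AddSubgroup (W.subgroupH1 p κ.kerSubgroup)} {z : W.subgroupH1 p κ.kerSubgroup},
      W.conjH1 p κ.kerSubgroup 1 z ∈ A → z ∈ A := fun {A z} h ↦ by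
    rwa [W.conjH1_one_holds p κ.kerSubgroup, AddMonoidHom.id_apply] at h
  -- AEU: `t` is unramified outside a finite `S₁` containing the bad places
  obtain ⟨S₁, hgood₁, htH⟩ := SignedEC.ResTwo.exists_finset_mem_unramifiedOutside W p κ.kerSubgroup t
  -- `Sel_∞` satisfies the classical Kummer condition at the chosen place above every finite `v`
  have hle : ∀ v : HeightOneSpectrum (𝓞 K), Sel ≤ W.localKerOver p κ.kerSubgroup (v.adicCompletion K) :=
    fun v x hx ↦ honeK (((W.mem_selmerGroupOver_iff p κ.kerSubgroup x).mp hx).1 v 1)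
  -- local lifts at every finite place (Greenberg p. 108) and at the archimedean places
  have hloc : ∀ v : HeightOneSpectrum (𝓞 K),
      ∃ xv : discreteH1 (localSubgroup (⊤ : Subgroup (absoluteGaloisGroup K)) (v.adicCompletion K))
          (localPoints W (v.adicCompletion K)),
        (∃ k : ℕ, p ^ k • xv = 0) ∧
        ∀ y : W.subgroupH1 p (⊤ : Subgroup (absoluteGaloisGroup K)),
          W.localResOver p ⊤ (v.adicCompletion K) y = xv →
          t - W.resOfLe p (le_top : κ.kerSubgroup ≤ ⊤) y ∈ W.localKerOver p κ.kerSubgroup (v.adicCompletion K) :=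
    fun v ↦ SSFlatEC.exists_localLift_of_localSurj W κ (hsurj v) Sel (hle v) t htall
  have hinf := fun w : InfinitePlace K ↦ SSFlatEC.exists_localLift_infinitePlace_top W κ w t
  let x : ∀ v : HeightOneSpectrum (𝓞 K),
      discreteH1 (localSubgroup (⊤ : Subgroup (absoluteGaloisGroup K)) (v.adicCompletion K))
        (localPoints W (v.adicCompletion K)) := fun v ↦ Classical.choose (hloc v)
  let xi : ∀ w : InfinitePlace K,
      discreteH1 (localSubgroup (⊤ : Subgroup (absoluteGaloisGroup K)) w.Completion) (localPoints W w.Completion) :=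
    fun w ↦ Classical.choose (hinf w)
  -- CASSELS WITH TORSION over `K`, away from `v₀`, with the finite set `S₁ ∪ {v₀}`
  obtain ⟨y, hyH, hyfin, hyinf⟩ := InputsGreenbergCasselsTorsion.casselsSurjectivity_H1Sigma_eraseOne W p hSel
    ((↑S₁ : Set (HeightOneSpectrum (𝓞 K))) ∪ {v₀}) (S₁.finite_toSet.union (Set.finite_singleton v₀))
    (fun v hv hpv ↦ hgood₁ v (fun h ↦ hv (Or.inl (Finset.mem_coe.mpr h))) hpv) v₀ (Or.inl (Or.inr rfl))
    x xi (fun v ↦ (Classical.choose_spec (hloc v)).1) (fun w ↦ (Classical.choose_spec (hinf w)).1)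
  -- `res y` is unramified outside `S₁ ∪ {v₀}` over `K_∞`
  have hyH' : W.resOfLe p (le_top : κ.kerSubgroup ≤ ⊤) y ∈
      unramifiedOutside κ.kerSubgroup (W.geomPrimaryTorsion p) p ((↑S₁ : Set (HeightOneSpectrum (𝓞 K))) ∪ {v₀}) :=
    SSFlatEC.resOfLe_mem_unramifiedOutside (W.geomPrimaryTorsion p) (le_top : κ.kerSubgroup ≤ ⊤) p _ hyH
  -- the local class of `t` at `v₀`: `p`-power torsion, invariant under the decomposition group, hence lifted by `hsurj`
  have htors : ∃ k : ℕ, p ^ k • W.localResOver p κ.kerSubgroup (v₀.adicCompletion K) t = 0 := by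
    obtain ⟨k, hk⟩ := W.exists_pow_smul_subgroupH1_ker_eq_zero κ t
    exact ⟨k, by rw [← map_nsmul, hk, map_zero]⟩
  have hinv : ∀ δ : absoluteGaloisGroup (v₀.adicCompletion K),
      Literature.NumberTheory.EllipticCurves.conjH1 (localSubgroup κ.kerSubgroup (v₀.adicCompletion K))
        (localPoints W (v₀.adicCompletion K)) δ (W.localResOver p κ.kerSubgroup (v₀.adicCompletion K) t) =
        W.localResOver p κ.kerSubgroup (v₀.adicCompletion K) t := fun δ ↦ by
    rw [← localResOver_conjH1_resGal]
    have h := hle v₀ (htall (resGal (K := K) (v₀.adicCompletion K) δ))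
    rw [mem_localKerOver_iff, map_sub, sub_eq_zero] at h
    exact h
  obtain ⟨x₀, hx₀tor, hrx₀⟩ := hsurj v₀ _ htors hinv
  -- the representative
  refine ⟨t - W.resOfLe p (le_top : κ.kerSubgroup ≤ ⊤) y, x₀ - W.localResOver p ⊤ (v₀.adicCompletion K) y,
    ?_, fun v hv ↦ ?_, fun w ↦ ?_, ?_, ?_⟩
  · -- `(conj_γ − 1)(t − res y) = (conj_γ − 1) t = s`
    rw [map_sub, SSFlatEC.conjH1_resOfLe_top W κ γ y, ← ht]
    abel
  · -- Kummer at every finite `v ≠ v₀`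
    by_cases h1 : (v ∈ ((↑S₁ : Set (HeightOneSpectrum (𝓞 K))) ∪ {v₀}) ∨ ((p : ℕ) : 𝓞 K) ∈ v.asIdeal)
    · exact (Classical.choose_spec (hloc v)).2 y (hyfin v h1 hv)
    · obtain ⟨hvS, hpv⟩ := not_or.mp h1
      have hv₁ : v ∉ S₁ := fun h ↦ hvS (Or.inl (Finset.mem_coe.mpr h))
      have h2 : W.conjH1 p κ.kerSubgroup 1 t ∈ W.localKerOver p κ.kerSubgroup (v.adicCompletion K) :=
        GreenbergVatsalUnramifiedAway.unramKer_le_localKerOver_of_isCyclotomic (κ := κ) (v := v) (W := W) (p := p)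
          hκ (hgood₁ v hv₁ hpv) hpv ((mem_unramifiedOutside_iff t).mp htH v hv₁ hpv 1)
      have h3 : W.conjH1 p κ.kerSubgroup 1 (W.resOfLe p (le_top : κ.kerSubgroup ≤ ⊤) y) ∈
          W.localKerOver p κ.kerSubgroup (v.adicCompletion K) :=
        GreenbergVatsalUnramifiedAway.unramKer_le_localKerOver_of_isCyclotomic (κ := κ) (v := v) (W := W) (p := p)
          hκ (hgood₁ v hv₁ hpv) hpv ((mem_unramifiedOutside_iff _).mp hyH' v hvS hpv 1)
      exact AddSubgroup.sub_mem _ (honeK h2) (honeK h3)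
  · -- Kummer at the infinite places
    exact (Classical.choose_spec (hinf w)).2 y (hyinf w)
  · -- `z₀` is `p`-power torsion
    obtain ⟨k, hk⟩ := hx₀tor
    obtain ⟨l, hl⟩ := SignedEC.H1SigmaCorank.exists_pow_smul_eq_zero_subgroupH1_top W p y
    refine ⟨k + l, ?_⟩
    have h1 : (p ^ k * p ^ l) • x₀ = 0 := by rw [mul_comm, mul_smul, hk, smul_zero]
    have h2 : (p ^ k * p ^ l) • W.localResOver p ⊤ (v₀.adicCompletion K) y = 0 := by
      rw [mul_smul, ← map_nsmul, hl, map_zero, smul_zero]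
    rw [pow_add, smul_sub, h1, h2, sub_zero]
  · -- `loc_{v₀}(t − res y) = r_{v₀}(x₀ − loc_{v₀} y)` (re-ascribed in local syntax: the implicit subgroups of `resOfLe`
    -- elaborate to unfolded `comap` forms, so `rw` across the two spellings is avoided)
    have hnat : W.localResOver p κ.kerSubgroup (v₀.adicCompletion K) (W.resOfLe p (le_top : κ.kerSubgroup ≤ ⊤) y) =
        Literature.NumberTheory.EllipticCurves.resOfLe (localPoints W (v₀.adicCompletion K))
          (Subgroup.comap_mono le_top :
            localSubgroup κ.kerSubgroup (v₀.adicCompletion K) ≤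
              localSubgroup (⊤ : Subgroup (absoluteGaloisGroup K)) (v₀.adicCompletion K))
          (W.localResOver p ⊤ (v₀.adicCompletion K) y) :=
      W.localResOverOfEmb_resOfLe p (closureEmb (K := K) (v₀.adicCompletion K)) (le_top : κ.kerSubgroup ≤ ⊤) y
    have hr : Literature.NumberTheory.EllipticCurves.resOfLe (localPoints W (v₀.adicCompletion K))
          (Subgroup.comap_mono le_top :
            localSubgroup κ.kerSubgroup (v₀.adicCompletion K) ≤
              localSubgroup (⊤ : Subgroup (absoluteGaloisGroup K)) (v₀.adicCompletion K)) x₀ =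
        W.localResOver p κ.kerSubgroup (v₀.adicCompletion K) t := hrx₀
    calc W.localResOver p κ.kerSubgroup (v₀.adicCompletion K) (t - W.resOfLe p (le_top : κ.kerSubgroup ≤ ⊤) y)
        = W.localResOver p κ.kerSubgroup (v₀.adicCompletion K) t -
            W.localResOver p κ.kerSubgroup (v₀.adicCompletion K) (W.resOfLe p (le_top : κ.kerSubgroup ≤ ⊤) y) :=
          map_sub _ _ _
      _ = Literature.NumberTheory.EllipticCurves.resOfLe (localPoints W (v₀.adicCompletion K))
            (Subgroup.comap_mono le_top :
              localSubgroup κ.kerSubgroup (v₀.adicCompletion K) ≤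
                localSubgroup (⊤ : Subgroup (absoluteGaloisGroup K)) (v₀.adicCompletion K)) x₀ -
          Literature.NumberTheory.EllipticCurves.resOfLe (localPoints W (v₀.adicCompletion K))
            (Subgroup.comap_mono le_top :
              localSubgroup κ.kerSubgroup (v₀.adicCompletion K) ≤
                localSubgroup (⊤ : Subgroup (absoluteGaloisGroup K)) (v₀.adicCompletion K))
            (W.localResOver p ⊤ (v₀.adicCompletion K) y) := by rw [hr]; exact congrArg _ hnat
      _ = _ := (map_sub _ _ _).symm

/-! ## §3 A `Θ`-lift of `z₀` kills the class of `(γ − 1)t` -/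

/-- **If the local class `z₀` of a representative `(t, z₀)` is the `v₀`-component of a class `Y ∈ H¹(Γ_K, E[p^∞])` unramified
outside `S ∪ {v₀}`, dying over `K_∞` on `S` and vanishing at `∞`, then `(γ−1)t ∈ (γ−1)Sel_∞`**: `t − res Y` is Selmer
(at `v₀` because `loc_{v₀} t = r_{v₀} z₀ = loc_{v₀}(res Y)`; on `S` by hypothesis; off `S ∪ {v₀}` both are unramified hence
Kummer over the cyclotomic tower; at the conjugate places because `conj_σ t − t ∈ Sel_∞`) and `(γ−1)(t − res Y) = (γ−1)t`.
[cite: GreenbergLNM1716, §4 Lemma 4.7 (pp. 107–108)] [cite: GreenbergVatsal2000, §2 pp. 16–17] -/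
theorem exists_mem_selmerInfty_conj_sub_eq_of_lift (hκ : κ.IsCyclotomic) (hγ : κ.IsTopGenerator γ)
    (S : Finset (HeightOneSpectrum (𝓞 K))) (hS : ∀ v ∉ S, ((p : ℕ) : 𝓞 K) ∉ v.asIdeal ∧ W.HasGoodReductionAt v)
    (v₀ : HeightOneSpectrum (𝓞 K)) (hv₀ : v₀ ∉ S) (t : W.subgroupH1 p κ.kerSubgroup)
    (z₀ : discreteH1 (localSubgroup (⊤ : Subgroup (absoluteGaloisGroup K)) (v₀.adicCompletion K))
      (localPoints W (v₀.adicCompletion K)))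
    (ht : W.conjH1 p κ.kerSubgroup γ t - t ∈ W.selmerInfty κ)
    (htv : ∀ v : HeightOneSpectrum (𝓞 K), v ≠ v₀ → t ∈ W.localKerOver p κ.kerSubgroup (v.adicCompletion K))
    (htw : ∀ w : InfinitePlace K, t ∈ W.localKerOver p κ.kerSubgroup w.Completion)
    (htz : W.localResOver p κ.kerSubgroup (v₀.adicCompletion K) t =
        Literature.NumberTheory.EllipticCurves.resOfLe (localPoints W (v₀.adicCompletion K))
          (Subgroup.comap_mono le_top :
            localSubgroup κ.kerSubgroup (v₀.adicCompletion K) ≤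
              localSubgroup (⊤ : Subgroup (absoluteGaloisGroup K)) (v₀.adicCompletion K)) z₀)
    (Y : W.subgroupH1 p (⊤ : Subgroup (absoluteGaloisGroup K)))
    (hYH : Y ∈ unramifiedOutside (⊤ : Subgroup (absoluteGaloisGroup K)) (W.geomPrimaryTorsion p) p
            ((↑S : Set (HeightOneSpectrum (𝓞 K))) ∪ {v₀}))
    (hYS : ∀ v ∈ S, Literature.NumberTheory.EllipticCurves.resOfLe (localPoints W (v.adicCompletion K))
            (Subgroup.comap_mono le_top :
              localSubgroup κ.kerSubgroup (v.adicCompletion K) ≤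
                localSubgroup (⊤ : Subgroup (absoluteGaloisGroup K)) (v.adicCompletion K))
            (W.localResOver p ⊤ (v.adicCompletion K) Y) = 0)
    (hYinf : ∀ w : InfinitePlace K, W.localResOver p ⊤ w.Completion Y = 0)
    (hY₀ : W.localResOver p ⊤ (v₀.adicCompletion K) Y = z₀) :
    ∃ t'' ∈ W.selmerInfty κ, W.conjH1 p κ.kerSubgroup γ t'' - t'' = W.conjH1 p κ.kerSubgroup γ t - t := by
  set Sel : AddSubgroup (W.subgroupH1 p κ.kerSubgroup) := W.selmerInfty κ with hSeldef
  have hstab : ∀ (σ : absoluteGaloisGroup K), ∀ x ∈ Sel, W.conjH1 p κ.kerSubgroup σ x ∈ Sel := fun σ x hx ↦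
    W.map_conjH1_selmerGroupOver_le_holds p κ.kerSubgroup σ ⟨x, hx, rfl⟩
  have htall : ∀ σ : absoluteGaloisGroup K, W.conjH1 p κ.kerSubgroup σ t - t ∈ Sel :=
    SSFlatEC.conjH1_sub_mem_of_conjH1_generator_sub_mem W κ hγ Sel hstab ht
  have honeK : ∀ {A : AddSubgroup (W.subgroupH1 p κ.kerSubgroup)} {z : W.subgroupH1 p κ.kerSubgroup},
      W.conjH1 p κ.kerSubgroup 1 z ∈ A → z ∈ A := fun {A z} h ↦ by
    rwa [W.conjH1_one_holds p κ.kerSubgroup, AddMonoidHom.id_apply] at h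
  have hsel' : ∀ σ, (∀ (v : HeightOneSpectrum (𝓞 K)) (τ : absoluteGaloisGroup K),
      W.conjH1 p κ.kerSubgroup τ (W.conjH1 p κ.kerSubgroup σ t - t) ∈ W.localKerOver p κ.kerSubgroup (v.adicCompletion K)) ∧
      ∀ (w : InfinitePlace K) (τ : absoluteGaloisGroup K),
        W.conjH1 p κ.kerSubgroup τ (W.conjH1 p κ.kerSubgroup σ t - t) ∈ W.localKerOver p κ.kerSubgroup w.Completion :=
    fun σ ↦ (W.mem_selmerGroupOver_iff p κ.kerSubgroup _).mp (htall σ)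
  -- the local behaviour of `res Y` over `K_∞`
  have hresS : ∀ v ∈ S, W.resOfLe p (le_top : κ.kerSubgroup ≤ ⊤) Y ∈ W.localKerOver p κ.kerSubgroup (v.adicCompletion K) := by
    intro v hv
    rw [mem_localKerOver_iff]
    change W.localResOverOfEmb p κ.kerSubgroup (closureEmb (K := K) (v.adicCompletion K)) _ = 0
    rw [W.localResOverOfEmb_resOfLe p (closureEmb (K := K) (v.adicCompletion K)) (le_top : κ.kerSubgroup ≤ ⊤) Y]
    exact hYS v hv
  have hres₀ : W.localResOver p κ.kerSubgroup (v₀.adicCompletion K) (W.resOfLe p (le_top : κ.kerSubgroup ≤ ⊤) Y) =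
      Literature.NumberTheory.EllipticCurves.resOfLe (localPoints W (v₀.adicCompletion K))
        (Subgroup.comap_mono le_top :
          localSubgroup κ.kerSubgroup (v₀.adicCompletion K) ≤
            localSubgroup (⊤ : Subgroup (absoluteGaloisGroup K)) (v₀.adicCompletion K)) z₀ := by
    rw [← hY₀]
    exact W.localResOverOfEmb_resOfLe p (closureEmb (K := K) (v₀.adicCompletion K)) (le_top : κ.kerSubgroup ≤ ⊤) Y
  have hresinf : ∀ w : InfinitePlace K,
      W.resOfLe p (le_top : κ.kerSubgroup ≤ ⊤) Y ∈ W.localKerOver p κ.kerSubgroup w.Completion := fun w ↦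
    SSFlatEC.resOfLe_top_mem_localKerOver_of_localResOver_eq_zero W κ Y (hYinf w)
  have hYH' : W.resOfLe p (le_top : κ.kerSubgroup ≤ ⊤) Y ∈
      unramifiedOutside κ.kerSubgroup (W.geomPrimaryTorsion p) p ((↑S : Set (HeightOneSpectrum (𝓞 K))) ∪ {v₀}) :=
    SSFlatEC.resOfLe_mem_unramifiedOutside (W.geomPrimaryTorsion p) (le_top : κ.kerSubgroup ≤ ⊤) p _ hYH
  have hsplit : ∀ σ : absoluteGaloisGroup K,
      W.conjH1 p κ.kerSubgroup σ (t - W.resOfLe p (le_top : κ.kerSubgroup ≤ ⊤) Y) =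
        (W.conjH1 p κ.kerSubgroup σ t - t) + (t - W.resOfLe p (le_top : κ.kerSubgroup ≤ ⊤) Y) := fun σ ↦ by
    rw [map_sub, SSFlatEC.conjH1_resOfLe_top W κ σ Y]; abel
  -- `t − res Y` is Selmer at the chosen place above every finite `v`
  have hfin : ∀ v : HeightOneSpectrum (𝓞 K),
      t - W.resOfLe p (le_top : κ.kerSubgroup ≤ ⊤) Y ∈ W.localKerOver p κ.kerSubgroup (v.adicCompletion K) := by
    intro v
    by_cases hv : v ∈ S
    · exact AddSubgroup.sub_mem _ (htv v (fun h ↦ hv₀ (h ▸ hv))) (hresS v hv)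
    · by_cases hvv₀ : v = v₀
      · subst hvv₀
        rw [mem_localKerOver_iff, map_sub, htz, hres₀, sub_self]
      · have hvS' : v ∉ ((↑S : Set (HeightOneSpectrum (𝓞 K))) ∪ {v₀}) := by
          rintro (h | h)
          · exact hv (Finset.mem_coe.mp h)
          · exact hvv₀ (Set.mem_singleton_iff.mp h)
        have h3 : W.conjH1 p κ.kerSubgroup 1 (W.resOfLe p (le_top : κ.kerSubgroup ≤ ⊤) Y) ∈
            W.localKerOver p κ.kerSubgroup (v.adicCompletion K) :=
          GreenbergVatsalUnramifiedAway.unramKer_le_localKerOver_of_isCyclotomic (κ := κ) (v := v) (W := W) (p := p)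
            hκ (hS v hv).2 (hS v hv).1 ((mem_unramifiedOutside_iff _).mp hYH' v hvS' (hS v hv).1 1)
        exact AddSubgroup.sub_mem _ (htv v hvv₀) (honeK h3)
  refine ⟨t - W.resOfLe p (le_top : κ.kerSubgroup ≤ ⊤) Y, ?_, ?_⟩
  · refine (W.mem_selmerGroupOver_iff p κ.kerSubgroup _).mpr ⟨fun v σ ↦ ?_, fun w σ ↦ ?_⟩
    · rw [hsplit σ]
      exact AddSubgroup.add_mem _ (honeK ((hsel' σ).1 v 1)) (hfin v)
    · rw [hsplit σ]
      exact AddSubgroup.add_mem _ (honeK ((hsel' σ).2 w 1)) (AddSubgroup.sub_mem _ (htw w) (hresinf w))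
  · rw [map_sub, SSFlatEC.conjH1_resOfLe_top W κ γ Y]
    abel

end Summit.BirchSwinnertonDyer.BirchSwinnertonDyer.Theorems.TorsionEulerChar

end
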